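import Summits.Ventures.Crystal3D.Theorems.StickyWulffConstantPolycrystalWulffBoundTwoClassArith
import Summits.Ventures.Crystal3D.Theorems.StickyWulffConstantPolycrystalWulffBoundWulffOverlapCap

/-!
# `PolycrystalWulffBound`, line `PolyDensity`: arithmetic of the CHARGED corners (dominant class at
# charge `c₁`, two classes at charge `11/10`, bulk at charge `3/2`) — crux `stmt-Ventures-19482`, poly-p2 g23

Route `StickyWulffConstant` of the venture `Summits/Ventures/Crystal3D`, second prover lane.  Pure real
arithmetic (Mathlib + the lane's decimal brackets), consumed by `…RungTwinFreeChargedSharp`: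

* `rpow_two_thirds_dominant_gen` — for `0 ≤ s ≤ σ·V`: `V^{2/3} ≤ (V − s)^{2/3} + κ·s^{2/3}` as soon as
  `(1−σ)^{2/3} + κ·σ^{2/3} ≥ 1` (given through decimal lower bounds `a ≤ (1−σ)^{2/3}`, `b ≤ σ^{2/3}`,
  `1 ≤ a + κ b`); the `σ = 3/20`, `κ = 0.37` instance is `rpow_two_thirds_dominant` (g3);
* `dominant_arith_gen` — the dominant-class LP at generic charge `c₁`: recolouring bound
  `w(V) − (√5−√3)Y + c₁A ≤ En`, per-class bound `w(v_D) + √3Y − (√5−c₁)A ≤ En`, isoperimetry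
  `c·s^{2/3} ≤ Y + A`, concavity `V^{2/3} ≤ v_D^{2/3} + κ s^{2/3}` ⟹ `w(V) ≤ En`, for any weight
  `u ∈ [0,1]` and margin `μ ≥ 0` with `μ ≤ u√3 − (1−u)(√5−√3)`, `μ ≤ c₁ − u√5`,
  `6·1.25993²·u·κ ≤ 4.835·μ`;
* `rpow_two_thirds_two_classes_gen` — `V = v₁ + v₂`, both `≥ σV` (`σ < 1/2`):
  `((1−σ)^{2/3} + σ^{2/3})·V^{2/3} ≤ v₁^{2/3} + v₂^{2/3}`;
* decimal brackets `rpow_four_fifths_lower` (`0.8617 ≤ (4/5)^{2/3}`), `rpow_one_fifth_lower`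
  (`0.3419 ≤ (1/5)^{2/3}`), `rpow_29_50_lower` (`0.6954 ≤ (29/50)^{2/3}`), `rpow_21_50_lower`
  (`0.5608 ≤ (21/50)^{2/3}`);
* `twoClass_arith_eleven_tenths` — balanced two-class case at overlap `26.61`, charge `11/10`, both
  classes `≥ V/5` (margin `0.5 %`); `bulk_pincer_arith_three_halves` — bulk at charge `3/2`,
  `Σ v^{2/3} ≥ 1.25·V^{2/3}` (margin `0.35 %`).
WHAT THIS IS NOT: geometry; the crux is not claimed.
-/

noncomputable section

namespace Summit.Ventures.Crystal3D.Cruxes.PolycrystalWulffBound.PolyDensity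

open Real Finset Summit.Ventures.Crystal3D.Theorems

/-! ### Decimal brackets -/

/-- If `0 ≤ d`, `0 ≤ q` and `d³ ≤ q²` then `d ≤ q^{2/3}`. -/
theorem rpow_two_thirds_lower_of_cube {q d : ℝ} (hq : 0 ≤ q) (hd : 0 ≤ d) (h : d ^ 3 ≤ q ^ 2) :
    d ≤ q ^ ((2 : ℝ) / 3) := by
  have e : q ^ ((2 : ℝ) / 3) = (q ^ 2) ^ ((1 : ℝ) / 3) := by
    rw [← Real.rpow_natCast q 2, ← Real.rpow_mul hq]; norm_num
  rw [e]
  exact le_rpow_third_of_cube_le hd h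

/-- `0.8617 ≤ (4/5)^{2/3}`. -/
theorem rpow_four_fifths_lower : (0.8617 : ℝ) ≤ (4 / 5 : ℝ) ^ ((2 : ℝ) / 3) :=
  rpow_two_thirds_lower_of_cube (by norm_num) (by norm_num) (by norm_num)

/-- `0.3419 ≤ (1/5)^{2/3}`. -/
theorem rpow_one_fifth_lower : (0.3419 : ℝ) ≤ (1 / 5 : ℝ) ^ ((2 : ℝ) / 3) :=
  rpow_two_thirds_lower_of_cube (by norm_num) (by norm_num) (by norm_num)

/-- `0.6954 ≤ (29/50)^{2/3}`. -/
theorem rpow_29_50_lower : (0.6954 : ℝ) ≤ (29 / 50 : ℝ) ^ ((2 : ℝ) / 3) :=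
  rpow_two_thirds_lower_of_cube (by norm_num) (by norm_num) (by norm_num)

/-- `0.5608 ≤ (21/50)^{2/3}`. -/
theorem rpow_21_50_lower : (0.5608 : ℝ) ≤ (21 / 50 : ℝ) ^ ((2 : ℝ) / 3) :=
  rpow_two_thirds_lower_of_cube (by norm_num) (by norm_num) (by norm_num)

/-! ### Concavity steps -/

/-- **Concavity step of the dominant corner, general fraction.**  For `0 < σ ≤ 1`, `κ ≥ 0`, decimal
lower bounds `a ≤ (1−σ)^{2/3}`, `b ≤ σ^{2/3}` with `1 ≤ a + κ·b`, and `0 ≤ s ≤ σ·V`: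
`V^{2/3} ≤ (V − s)^{2/3} + κ·s^{2/3}`. -/
theorem rpow_two_thirds_dominant_gen {σ κ a b V s : ℝ} (hσ0 : 0 < σ) (hσ1 : σ ≤ 1) (hκ : 0 ≤ κ)
    (ha : a ≤ (1 - σ) ^ ((2 : ℝ) / 3)) (hb : b ≤ σ ^ ((2 : ℝ) / 3)) (hend : 1 ≤ a + κ * b)
    (hV : 0 ≤ V) (hs0 : 0 ≤ s) (hs : s ≤ σ * V) :
    V ^ ((2 : ℝ) / 3) ≤ (V - s) ^ ((2 : ℝ) / 3) + κ * s ^ ((2 : ℝ) / 3) := by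
  rcases hV.eq_or_lt with hV0 | hVpos
  · have hs00 : s = 0 := le_antisymm (by rw [← hV0] at hs; linarith) hs0
    rw [← hV0, hs00, sub_zero, Real.zero_rpow (by norm_num)]
    norm_num
  set θ : ℝ := s / (σ * V) with hθ
  have hden : 0 < σ * V := by positivity
  have hθ0 : 0 ≤ θ := div_nonneg hs0 hden.le
  have hθ1 : θ ≤ 1 := (div_le_one hden).2 hs
  have hθs : θ * (σ * V) = s := div_mul_cancel₀ s hden.ne'
  have hconc := (Real.concaveOn_rpow (p := (2 : ℝ) / 3) (by norm_num) (by norm_num)).2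
  have h1σ : 0 ≤ 1 - σ := by linarith
  have hA : θ * (((1 - σ) * V) ^ ((2 : ℝ) / 3)) + (1 - θ) * V ^ ((2 : ℝ) / 3) ≤
      (V - s) ^ ((2 : ℝ) / 3) := by
    have h := hconc (Set.mem_Ici.2 (by positivity : (0 : ℝ) ≤ (1 - σ) * V)) (Set.mem_Ici.2 hV) hθ0
      (sub_nonneg.2 hθ1) (by ring)
    simp only [smul_eq_mul] at h
    have heq : θ * ((1 - σ) * V) + (1 - θ) * V = V - s := by rw [← hθs]; ring
    rw [heq] at h
    exact h
  have hB : θ * ((σ * V) ^ ((2 : ℝ) / 3)) ≤ s ^ ((2 : ℝ) / 3) := by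
    have h := hconc (Set.mem_Ici.2 hden.le) (Set.mem_Ici.2 (le_refl (0 : ℝ))) hθ0
      (sub_nonneg.2 hθ1) (by ring)
    simp only [smul_eq_mul, mul_zero, add_zero, Real.zero_rpow (by norm_num : (2 : ℝ) / 3 ≠ 0)] at h
    rw [hθs] at h
    exact h
  have hW0 : 0 ≤ V ^ ((2 : ℝ) / 3) := by positivity
  have e1 : ((1 - σ) * V) ^ ((2 : ℝ) / 3) = (1 - σ) ^ ((2 : ℝ) / 3) * V ^ ((2 : ℝ) / 3) :=
    Real.mul_rpow h1σ hV
  have e2 : (σ * V) ^ ((2 : ℝ) / 3) = σ ^ ((2 : ℝ) / 3) * V ^ ((2 : ℝ) / 3) :=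
    Real.mul_rpow hσ0.le hV
  rw [e1] at hA
  rw [e2] at hB
  have hend' : V ^ ((2 : ℝ) / 3) ≤ ((1 - σ) ^ ((2 : ℝ) / 3)) * V ^ ((2 : ℝ) / 3) +
      κ * ((σ ^ ((2 : ℝ) / 3)) * V ^ ((2 : ℝ) / 3)) := by
    nlinarith [mul_le_mul_of_nonneg_right ha hW0, mul_le_mul_of_nonneg_right hb hW0,
      mul_le_mul_of_nonneg_left (mul_le_mul_of_nonneg_right hb hW0) hκ]
  have hσW : 0 ≤ σ ^ ((2 : ℝ) / 3) * V ^ ((2 : ℝ) / 3) := by positivity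
  nlinarith [mul_le_mul_of_nonneg_left hend' hθ0, hA, hB, hW0, hθ0, hθ1,
    mul_nonneg hθ0 hσW, mul_le_mul_of_nonneg_left hB hκ, mul_nonneg hκ (mul_nonneg hθ0 hσW)]

/-- **Concavity step of the two-class corner, general fraction.**  For `V = v₁ + v₂` with both
`v_i ≥ σ·V`, `0 < σ < 1/2`: `((1−σ)^{2/3} + σ^{2/3})·V^{2/3} ≤ v₁^{2/3} + v₂^{2/3}`. -/
theorem rpow_two_thirds_two_classes_gen {σ V v₁ v₂ : ℝ} (hσ0 : 0 < σ) (hσ : σ < 1 / 2)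
    (hV : V = v₁ + v₂) (h1 : σ * V ≤ v₁) (h2 : σ * V ≤ v₂) :
    ((1 - σ) ^ ((2 : ℝ) / 3) + σ ^ ((2 : ℝ) / 3)) * V ^ ((2 : ℝ) / 3) ≤
      v₁ ^ ((2 : ℝ) / 3) + v₂ ^ ((2 : ℝ) / 3) := by
  have hV0 : 0 ≤ V := by nlinarith
  rcases hV0.eq_or_lt with hV00 | hVpos
  · have hv1 : v₁ = 0 := by nlinarith
    have hv2 : v₂ = 0 := by nlinarith
    rw [← hV00, hv1, hv2, Real.zero_rpow (by norm_num)]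
    simp
  have hv1 : 0 ≤ v₁ := le_trans (by positivity) h1
  have hv2 : 0 ≤ v₂ := le_trans (by positivity) h2
  have h1σ : 0 ≤ 1 - σ := by linarith
  set μ : ℝ := (v₁ - σ * V) / ((1 - 2 * σ) * V) with hμ
  have hden : 0 < (1 - 2 * σ) * V := mul_pos (by linarith) hVpos
  have hμ0 : 0 ≤ μ := div_nonneg (by linarith) hden.le
  have hμ1 : μ ≤ 1 := (div_le_one hden).2 (by nlinarith)
  have hμv : μ * ((1 - 2 * σ) * V) = v₁ - σ * V := div_mul_cancel₀ _ hden.ne'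
  have e1 : μ * ((1 - σ) * V) + (1 - μ) * (σ * V) = v₁ := by nlinarith
  have e2 : μ * (σ * V) + (1 - μ) * ((1 - σ) * V) = v₂ := by nlinarith
  have hconc := (Real.concaveOn_rpow (p := (2 : ℝ) / 3) (by norm_num) (by norm_num)).2
  have h17m : ((1 - σ) * V) ∈ Set.Ici (0 : ℝ) := Set.mem_Ici.2 (by positivity)
  have h3m : (σ * V) ∈ Set.Ici (0 : ℝ) := Set.mem_Ici.2 (by positivity)
  have hA : μ * ((1 - σ) * V) ^ ((2 : ℝ) / 3) + (1 - μ) * (σ * V) ^ ((2 : ℝ) / 3) ≤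
      v₁ ^ ((2 : ℝ) / 3) := by
    have h := hconc h17m h3m hμ0 (sub_nonneg.2 hμ1) (by ring)
    simp only [smul_eq_mul] at h
    rwa [e1] at h
  have hB : μ * (σ * V) ^ ((2 : ℝ) / 3) + (1 - μ) * ((1 - σ) * V) ^ ((2 : ℝ) / 3) ≤
      v₂ ^ ((2 : ℝ) / 3) := by
    have h := hconc h3m h17m hμ0 (sub_nonneg.2 hμ1) (by ring)
    simp only [smul_eq_mul] at h
    rwa [e2] at h
  have e17 : ((1 - σ) * V) ^ ((2 : ℝ) / 3) = (1 - σ) ^ ((2 : ℝ) / 3) * V ^ ((2 : ℝ) / 3) :=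
    Real.mul_rpow h1σ hV0
  have e3 : (σ * V) ^ ((2 : ℝ) / 3) = σ ^ ((2 : ℝ) / 3) * V ^ ((2 : ℝ) / 3) :=
    Real.mul_rpow hσ0.le hV0
  rw [e17, e3] at hA hB
  nlinarith [hA, hB]

/-! ### The dominant-class LP at generic charge `c₁` -/

set_option maxHeartbeats 400000 in
/-- **Dominant-class corner at charge `c₁` (arithmetic).**  Let `c > 0` with `c³ ≥ 36π`, volumes
`V = v_D + s` (`v_D, s ≥ 0`) with the concavity bound `V^{2/3} ≤ v_D^{2/3} + κ·s^{2/3}` (`κ ≥ 0`),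
nonnegative areas `Y, A` with `c·s^{2/3} ≤ Y + A`, and an energy `En` with the recolouring bound
`w(V) − (√5 − √3)·Y + c₁·A ≤ En` and the per-class bound `w(v_D) + √3·Y − (√5 − c₁)·A ≤ En`.  If some
weight `u ∈ [0,1]` and margin `μ ≥ 0` satisfy `μ ≤ u√3 − (1−u)(√5−√3)`, `μ ≤ c₁ − u√5` and
`6·1.25993²·u·κ ≤ 4.835·μ`, then `w(V) ≤ En` (`w(v) = 6·2^{1/3}(√2 v)^{2/3}`). -/
theorem dominant_arith_gen {c c₁ κ u μ V vD s Y A En : ℝ} (hc : 0 < c)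
    (hc3 : 36 * Real.pi ≤ c ^ 3) (hvD : 0 ≤ vD) (hs0 : 0 ≤ s) (hV : V = vD + s) (hκ : 0 ≤ κ)
    (hκs : V ^ ((2 : ℝ) / 3) ≤ vD ^ ((2 : ℝ) / 3) + κ * s ^ ((2 : ℝ) / 3))
    (hY : 0 ≤ Y) (hA : 0 ≤ A) (hiso : c * s ^ ((2 : ℝ) / 3) ≤ Y + A)
    (h1 : 6 * (2 : ℝ) ^ ((1 : ℝ) / 3) * (Real.sqrt 2 * V) ^ ((2 : ℝ) / 3) -
      (Real.sqrt 5 - Real.sqrt 3) * Y + c₁ * A ≤ En)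
    (h2 : 6 * (2 : ℝ) ^ ((1 : ℝ) / 3) * (Real.sqrt 2 * vD) ^ ((2 : ℝ) / 3) +
      Real.sqrt 3 * Y - (Real.sqrt 5 - c₁) * A ≤ En)
    (hu0 : 0 ≤ u) (hu1 : u ≤ 1) (hμ0 : 0 ≤ μ)
    (hcy : μ ≤ u * Real.sqrt 3 - (1 - u) * (Real.sqrt 5 - Real.sqrt 3))
    (hca : μ ≤ c₁ - u * Real.sqrt 5) (hbal : 6 * (1.25993 : ℝ) ^ 2 * u * κ ≤ 4.835 * μ) :
    6 * (2 : ℝ) ^ ((1 : ℝ) / 3) * (Real.sqrt 2 * V) ^ ((2 : ℝ) / 3) ≤ En := by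
  have hV0 : 0 ≤ V := by rw [hV]; positivity
  rw [wulffConstant_eq' hV0] at h1 ⊢
  rw [wulffConstant_eq' hvD] at h2
  obtain ⟨ht1, ht2, -⟩ := cbrt_two_bounds
  set t : ℝ := (2 : ℝ) ^ ((1 : ℝ) / 3) with ht
  have ht0 : 0 ≤ t := by positivity
  set W : ℝ := V ^ ((2 : ℝ) / 3) with hW
  set WD : ℝ := vD ^ ((2 : ℝ) / 3) with hWD
  set Z : ℝ := s ^ ((2 : ℝ) / 3) with hZ
  have hW0 : 0 ≤ W := by positivity
  have hWD0 : 0 ≤ WD := by positivity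
  have hZ0 : 0 ≤ Z := by positivity
  have hc1 : (4.835 : ℝ) ≤ c := isoConst_lower hc hc3
  have ht2u : t ^ 2 ≤ (1.25993 : ℝ) ^ 2 := by gcongr
  -- the convex combination `u·h2 + (1−u)·h1`
  have hcomb := add_le_add (mul_le_mul_of_nonneg_left h2 hu0) (mul_le_mul_of_nonneg_left h1 (sub_nonneg.2 hu1))
  -- the deficit `6t²u(W − W_D)` against the area credits
  have p1 : 6 * t ^ 2 * u * (W - WD) ≤ 6 * t ^ 2 * u * (κ * Z) :=
    mul_le_mul_of_nonneg_left (by linarith) (by positivity)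
  have p2 : 6 * t ^ 2 * u * (κ * Z) ≤ 6 * (1.25993 : ℝ) ^ 2 * u * (κ * Z) := by
    have : 0 ≤ u * (κ * Z) := by positivity
    nlinarith [mul_le_mul_of_nonneg_right ht2u this]
  have p3 : 6 * (1.25993 : ℝ) ^ 2 * u * (κ * Z) ≤ 4.835 * μ * Z := by
    nlinarith [mul_le_mul_of_nonneg_right hbal hZ0]
  have p4 : (4.835 : ℝ) * μ * Z ≤ μ * (c * Z) := by
    nlinarith [mul_le_mul_of_nonneg_right hc1 (mul_nonneg hμ0 hZ0)]
  have p5 : μ * (c * Z) ≤ μ * (Y + A) := mul_le_mul_of_nonneg_left hiso hμ0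
  have p6 : μ * Y ≤ (u * Real.sqrt 3 - (1 - u) * (Real.sqrt 5 - Real.sqrt 3)) * Y :=
    mul_le_mul_of_nonneg_right hcy hY
  have p7 : μ * A ≤ (c₁ - u * Real.sqrt 5) * A := mul_le_mul_of_nonneg_right hca hA
  nlinarith [hcomb, p1, p2, p3, p4, p5, p6, p7]

/-! ### The two concrete corners of the charged rungs -/

/-- **Two-class corner at charge `11/10` (arithmetic).**  `V = v₁ + v₂` with both `v_i ≥ V/5`,
`V_K ≥ 26.61`, `D ≥ 0`, `3·V_K^{1/3}·V^{2/3} + (11/20)·D ≤ En` and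
`w(v₁) + w(v₂) − (√5 − 11/20)·D ≤ En` ⟹ `w(V) ≤ En` (margin `0.5 %`). -/
theorem twoClass_arith_eleven_tenths {V v₁ v₂ VK D En : ℝ} (hV : V = v₁ + v₂) (h1 : 1 / 5 * V ≤ v₁)
    (h2 : 1 / 5 * V ≤ v₂) (hVK : (26.61 : ℝ) ≤ VK) (hD : 0 ≤ D)
    (hK : 3 * VK ^ ((1 : ℝ) / 3) * V ^ ((2 : ℝ) / 3) + 11 / 20 * D ≤ En)
    (hP : 6 * (2 : ℝ) ^ ((1 : ℝ) / 3) * (Real.sqrt 2 * v₁) ^ ((2 : ℝ) / 3) +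
      6 * (2 : ℝ) ^ ((1 : ℝ) / 3) * (Real.sqrt 2 * v₂) ^ ((2 : ℝ) / 3) -
        (Real.sqrt 5 - 11 / 20) * D ≤ En) :
    6 * (2 : ℝ) ^ ((1 : ℝ) / 3) * (Real.sqrt 2 * V) ^ ((2 : ℝ) / 3) ≤ En := by
  have hV0 : 0 ≤ V := by nlinarith
  have hv1 : 0 ≤ v₁ := le_trans (by positivity) h1
  have hv2 : 0 ≤ v₂ := le_trans (by positivity) h2
  rw [wulffConstant_eq' hV0]
  rw [wulffConstant_eq' hv1, wulffConstant_eq' hv2] at hP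
  obtain ⟨ht1, ht2, -⟩ := cbrt_two_bounds
  set t : ℝ := (2 : ℝ) ^ ((1 : ℝ) / 3) with ht
  have ht0 : 0 ≤ t := by positivity
  have hkey := rpow_two_thirds_two_classes_gen (σ := 1 / 5) (by norm_num) (by norm_num) hV h1 h2
  have ha := rpow_four_fifths_lower
  have hb := rpow_one_fifth_lower
  rw [show (1 - 1 / 5 : ℝ) = 4 / 5 by norm_num] at hkey
  set W : ℝ := V ^ ((2 : ℝ) / 3) with hW
  set W1 : ℝ := v₁ ^ ((2 : ℝ) / 3) with hW1
  set W2 : ℝ := v₂ ^ ((2 : ℝ) / 3) with hW2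
  have hW0 : 0 ≤ W := by positivity
  have hW10 : 0 ≤ W1 := by positivity
  have hW20 : 0 ≤ W2 := by positivity
  have hsum : (1.2036 : ℝ) * W ≤ W1 + W2 := by nlinarith [hkey, ha, hb, hW0]
  have hcbrt : (2.985 : ℝ) ≤ VK ^ ((1 : ℝ) / 3) :=
    le_rpow_third_of_cube_le (by norm_num) (le_trans (by norm_num) hVK)
  have h5l : (2.236 : ℝ) ≤ Real.sqrt 5 := sqrt_five_lower'
  have h5u : Real.sqrt 5 ≤ (2.2361 : ℝ) := sqrt_five_upper
  have ht2l : (1.2599 : ℝ) ^ 2 ≤ t ^ 2 := by gcongr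
  have ht2u : t ^ 2 ≤ (1.25993 : ℝ) ^ 2 := by gcongr
  have p1 : (2.985 : ℝ) * W ≤ VK ^ ((1 : ℝ) / 3) * W := mul_le_mul_of_nonneg_right hcbrt hW0
  have p2 : (1.2599 : ℝ) ^ 2 * (W1 + W2) ≤ t ^ 2 * (W1 + W2) :=
    mul_le_mul_of_nonneg_right ht2l (by positivity)
  have p3 : t ^ 2 * W ≤ (1.25993 : ℝ) ^ 2 * W := mul_le_mul_of_nonneg_right ht2u hW0
  have p4 : (Real.sqrt 5 - 11 / 20) * D ≤ (2.2361 - 11 / 20) * D :=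
    mul_le_mul_of_nonneg_right (by linarith) hD
  nlinarith [hK, hP, p1, p2, p3, p4, hsum, hD, hW0, hW10, hW20, sq_nonneg t]

/-- **Bulk arithmetic at charge `3/2`.**  Let `c > 0` with `c³ ≥ 36π`, class volumes `v ℓ ≥ 0`, `V ≥ 0`
with `1.25·V^{2/3} ≤ Σ (v ℓ)^{2/3}`, free area `F ≥ c V^{2/3}`, `D ≥ 0`, `√3 F + (3/4)·D ≤ En` and
`Σ_ℓ w(v ℓ) − (√5 − 3/4)·D ≤ En`.  Then `w(V) ≤ En` (margin `0.35 %`). -/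
theorem bulk_pincer_arith_three_halves {κ : Type*} (s : Finset κ) {v : κ → ℝ} {c V F D En : ℝ}
    (hc : 0 < c) (hc3 : 36 * Real.pi ≤ c ^ 3) (hV0 : 0 ≤ V) (hv : ∀ i ∈ s, 0 ≤ v i)
    (hbulk : (1.25 : ℝ) * V ^ ((2 : ℝ) / 3) ≤ ∑ i ∈ s, v i ^ ((2 : ℝ) / 3))
    (hF : c * V ^ ((2 : ℝ) / 3) ≤ F) (hD : 0 ≤ D)
    (h1 : Real.sqrt 3 * F + 3 / 4 * D ≤ En)
    (h2 : (∑ i ∈ s, 6 * (2 : ℝ) ^ ((1 : ℝ) / 3) * (Real.sqrt 2 * v i) ^ ((2 : ℝ) / 3)) -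
      (Real.sqrt 5 - 3 / 4) * D ≤ En) :
    6 * (2 : ℝ) ^ ((1 : ℝ) / 3) * (Real.sqrt 2 * V) ^ ((2 : ℝ) / 3) ≤ En := by
  rw [wulffConstant_eq' hV0]
  obtain ⟨ht1, ht2, -⟩ := cbrt_two_bounds
  set t : ℝ := (2 : ℝ) ^ ((1 : ℝ) / 3) with ht
  have ht0 : 0 ≤ t := by positivity
  set W : ℝ := V ^ ((2 : ℝ) / 3) with hW
  have hW0 : 0 ≤ W := by positivity
  set Q : ℝ := ∑ i ∈ s, v i ^ ((2 : ℝ) / 3) with hQ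
  have hQ0 : 0 ≤ Q := sum_nonneg fun i hi => Real.rpow_nonneg (hv i hi) _
  have hsum : (∑ i ∈ s, 6 * (2 : ℝ) ^ ((1 : ℝ) / 3) * (Real.sqrt 2 * v i) ^ ((2 : ℝ) / 3)) =
      6 * t ^ 2 * Q := by
    rw [hQ, mul_sum]
    refine sum_congr rfl fun i hi => ?_
    rw [wulffConstant_eq' (hv i hi)]
  rw [hsum] at h2
  have h3 : (1.732 : ℝ) ≤ Real.sqrt 3 := sqrt_three_lower
  have h5 : Real.sqrt 5 ≤ (2.2361 : ℝ) := sqrt_five_upper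
  have hc1 : (4.835 : ℝ) ≤ c := isoConst_lower hc hc3
  have hFW : c * W ≤ F := hF
  have p1 : Real.sqrt 5 * D ≤ 2.2361 * D := mul_le_mul_of_nonneg_right h5 hD
  have p2 : t ^ 2 * ((1.25 : ℝ) * W) ≤ t ^ 2 * Q := mul_le_mul_of_nonneg_left hbulk (sq_nonneg t)
  have ht2l : (1.2599 : ℝ) ^ 2 ≤ t ^ 2 := by gcongr
  have ht2u : t ^ 2 ≤ (1.25993 : ℝ) ^ 2 := by gcongr
  have p3 : (1.2599 : ℝ) ^ 2 * ((1.25 : ℝ) * W) ≤ t ^ 2 * ((1.25 : ℝ) * W) :=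
    mul_le_mul_of_nonneg_right ht2l (by positivity)
  have p5 : Real.sqrt 3 * (c * W) ≤ Real.sqrt 3 * F := mul_le_mul_of_nonneg_left hFW (Real.sqrt_nonneg 3)
  have p6 : (1.732 : ℝ) * (c * W) ≤ Real.sqrt 3 * (c * W) :=
    mul_le_mul_of_nonneg_right h3 (mul_nonneg hc.le hW0)
  have p7 : (4.835 : ℝ) * W ≤ c * W := mul_le_mul_of_nonneg_right hc1 hW0
  have p8 : t ^ 2 * W ≤ (1.25993 : ℝ) ^ 2 * W := mul_le_mul_of_nonneg_right ht2u hW0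
  nlinarith [p1, p2, p3, p5, p6, p7, p8, hD, hW0, hQ0, h1, h2]

end Summit.Ventures.Crystal3D.Cruxes.PolycrystalWulffBound.PolyDensity

end
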